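import Mathlib.MeasureTheory.Integral.Prod
import Mathlib.MeasureTheory.Function.L2Space
import Literature.Analysis.OperatorTheory.PositiveKernelTransferOperator
import HarnessLib

/-!
# Integral operators with square-integrable kernels on `L²` (Reed–Simon I, Thm. VI.23) — PROVED

Topic `Literature/Analysis/OperatorTheory`; theorems only (no definition, no named fact, no instance).
Companion of `IntegralOperatorHilbertSchmidt.lean` / `PositiveKernelTransferOperator.lean`, which treat
BOUNDED kernels on a finite measure space. Here the kernel `K : X → X → ℝ` on an s-finite measure space
`(X, μ)` is only assumed SQUARE INTEGRABLE, `uncurry K ∈ L²(μ ⊗ μ)`, and we assemble the classical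
Hilbert–Schmidt package for the integral operator `(Aφ)(x) = ∫ K(x, y) φ(y) dμ(y)` on the real Hilbert
space `Lp ℝ 2 μ` (Reed–Simon I, Thm. VI.23: an `L²` kernel defines a bounded — indeed Hilbert–Schmidt —
operator with `‖A‖²_{HS} = ∫∫ |K|²`):

* `ae_memLp_l2Kernel_section` — for a.e. `x` the section `K(x, ·)` is in `L²(μ)` (Tonelli);
* `integral_l2Kernel_mul_eq_inner`, `sq_integral_l2Kernel_mul_le` — `(Aφ)(x) = ⟪K(x,·), φ⟫` and the
  row-wise Cauchy–Schwarz bound `(Aφ)(x)² ≤ (∫ K(x,y)² dμ(y)) ‖φ‖²` for such `x`;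
* `memLp_two_integral_l2Kernel_mul`, `integral_sq_integral_l2Kernel_mul_le` — `Aφ ∈ L²` with
  `∫ (Aφ)² ≤ ‖K‖²_{L²(μ⊗μ)} ‖φ‖²`;
* `exists_l2KernelOp` — existence of the bounded operator with the a.e. kernel formula (no definition is
  introduced; every further property is stated for ANY bounded `A` with
  `hA : ∀ φ, A φ =ᵐ[μ] fun x => ∫ y, K x y * φ y ∂μ`);
* `sum_norm_sq_l2KernelOp_le` — **the Hilbert–Schmidt bound** `∑ᵢ ‖A fᵢ‖² ≤ ∫∫ K²` for every finite
  orthonormal family (row-wise Bessel inequality, integrated), hence `isCompactOperator_l2KernelOp`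
  (tree `isCompactOperator_of_orthonormal_sum_sq_le`, Reed–Simon I, Thm. VI.22);
* `integrable_mul_l2Kernel_mul`, `isSelfAdjoint_l2KernelOp` — `ψ(x) K(x,y) φ(y)` is integrable on
  `μ ⊗ μ` (`ψ ⊗ φ ∈ L²(μ ⊗ μ)`), so a symmetric kernel gives a self-adjoint operator (Fubini);
* `exists_l2KernelOp_package` — everything in one statement (the form consumed on the summit side).

The inner-product formula `⟪ψ, Aφ⟫ = ∫ ψ(x) (∫ K(x,y) φ(y))` is the tree's `inner_kernelOp_eq_integral`
(valid for any kernel). Sources: M. Reed, B. Simon, *Methods of Modern Mathematical Physics I: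
Functional Analysis* (1980), §VI.6, Thm. VI.22–VI.23 [`ReedSimonI1980`].
-/

noncomputable section

open _root_.MeasureTheory Set Filter Function
open scoped RealInnerProductSpace ENNReal

namespace Literature.Analysis.OperatorTheory

variable {X : Type*} [MeasurableSpace X] {μ : Measure X} {K : X → X → ℝ}

/-! ### Square-integrable sections -/

/-- `∫ K(x, y) φ(y) dμ(y) = ⟪K(x, ·), φ⟫_{L²}` whenever the section `K(x, ·)` is in `L²`. [folklore] -/
theorem integral_l2Kernel_mul_eq_inner {x : X} (hx : MemLp (K x) 2 μ) (φ : Lp ℝ 2 μ) :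
    ∫ y, K x y * φ y ∂μ = ⟪hx.toLp (K x), φ⟫ := by
  rw [inner_eq_integral]
  refine integral_congr_ae ?_
  filter_upwards [hx.coeFn_toLp] with y hy
  rw [hy]

/-- `‖K(x, ·)‖²_{L²} = ∫ K(x, y)² dμ(y)`. [folklore] -/
theorem norm_toLp_l2Kernel_section_sq {x : X} (hx : MemLp (K x) 2 μ) :
    ‖hx.toLp (K x)‖ ^ 2 = ∫ y, K x y ^ 2 ∂μ := by
  rw [norm_toLp_sq_eq_integral_norm_sq]
  simp only [Real.norm_eq_abs, sq_abs]

/-- **Row-wise Cauchy–Schwarz**: `(∫ K(x,y) φ(y) dμ(y))² ≤ (∫ K(x,y)² dμ(y)) ‖φ‖²` whenever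
`K(x, ·) ∈ L²`. [folklore] -/
theorem sq_integral_l2Kernel_mul_le {x : X} (hx : MemLp (K x) 2 μ) (φ : Lp ℝ 2 μ) :
    (∫ y, K x y * φ y ∂μ) ^ 2 ≤ (∫ y, K x y ^ 2 ∂μ) * ‖φ‖ ^ 2 := by
  rw [integral_l2Kernel_mul_eq_inner hx, ← norm_toLp_l2Kernel_section_sq hx, ← mul_pow, ← sq_abs]
  exact pow_le_pow_left₀ (abs_nonneg _) (abs_real_inner_le_norm _ _) 2

/-- **Row-wise Bessel inequality**: for a finite orthonormal family `(fᵢ)` of `L²(μ)`,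
`∑ᵢ (∫ K(x,y) fᵢ(y) dμ(y))² ≤ ∫ K(x,y)² dμ(y)` whenever `K(x, ·) ∈ L²`. [folklore] -/
theorem sum_sq_integral_l2Kernel_mul_le {x : X} (hx : MemLp (K x) 2 μ) {m : ℕ} {f : Fin m → Lp ℝ 2 μ}
    (hf : Orthonormal ℝ f) : ∑ i, (∫ y, K x y * f i y ∂μ) ^ 2 ≤ ∫ y, K x y ^ 2 ∂μ := by
  rw [← norm_toLp_l2Kernel_section_sq hx]
  have h := hf.sum_inner_products_le (hx.toLp (K x)) (s := Finset.univ)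
  refine le_trans (le_of_eq (Finset.sum_congr rfl fun i _ => ?_)) h
  rw [integral_l2Kernel_mul_eq_inner hx, Real.norm_eq_abs, sq_abs, real_inner_comm]

/-- `ψ ⊗ φ ∈ L²(μ ⊗ μ)` for `ψ, φ ∈ L²(μ)`. [folklore] -/
theorem memLp_two_tensor_of_memLp {ψ φ : X → ℝ} (hψ : MemLp ψ 2 μ) (hφ : MemLp φ 2 μ) :
    MemLp (fun z : X × X => ψ z.1 * φ z.2) 2 (μ.prod μ) := by
  have hmeas : AEStronglyMeasurable (fun z : X × X => ψ z.1 * φ z.2) (μ.prod μ) :=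
    hψ.1.comp_fst.mul hφ.1.comp_snd
  rw [memLp_two_iff_integrable_sq hmeas]
  refine (hψ.integrable_sq.mul_prod hφ.integrable_sq).congr (Eventually.of_forall fun z => ?_)
  simp only
  ring

/-- The double integrand `ψ(x) K(x,y) φ(y)` is integrable on `μ ⊗ μ` (`K` and `ψ ⊗ φ` are both in
`L²(μ ⊗ μ)`). [folklore] -/
theorem integrable_mul_l2Kernel_mul (hK : MemLp (uncurry K) 2 (μ.prod μ)) (ψ φ : Lp ℝ 2 μ) :
    Integrable (fun z : X × X => ψ z.1 * (K z.1 z.2 * φ z.2)) (μ.prod μ) := by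
  have h := hK.integrable_mul (memLp_two_tensor_of_memLp (Lp.memLp ψ) (Lp.memLp φ))
  refine h.congr (Eventually.of_forall fun z => ?_)
  simp only [Pi.mul_apply, uncurry]
  ring

variable [SFinite μ]

/-- For an `L²(μ ⊗ μ)` kernel, almost every section `K(x, ·)` is in `L²(μ)` (Tonelli). [folklore] -/
theorem ae_memLp_l2Kernel_section (hK : MemLp (uncurry K) 2 (μ.prod μ)) : ∀ᵐ x ∂μ, MemLp (K x) 2 μ := by
  have h1 : ∀ᵐ x ∂μ, AEStronglyMeasurable (fun y => uncurry K (x, y)) μ := hK.1.prodMk_left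
  have h2 : ∀ᵐ x ∂μ, Integrable (fun y => (fun z => uncurry K z ^ 2) (x, y)) μ :=
    hK.integrable_sq.prod_right_ae
  filter_upwards [h1, h2] with x hx1 hx2
  exact (memLp_two_iff_integrable_sq hx1).2 hx2

/-- `x ↦ ∫ K(x,y)² dμ(y)` is integrable, for an `L²(μ ⊗ μ)` kernel. [folklore] -/
theorem integrable_integral_l2Kernel_sq (hK : MemLp (uncurry K) 2 (μ.prod μ)) :
    Integrable (fun x => ∫ y, K x y ^ 2 ∂μ) μ :=
  hK.integrable_sq.integral_prod_left

/-- `∫ (∫ K(x,y)² dμ(y)) dμ(x) = ∫ K² d(μ ⊗ μ)` (Fubini). [folklore] -/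
theorem integral_integral_l2Kernel_sq (hK : MemLp (uncurry K) 2 (μ.prod μ)) :
    ∫ x, ∫ y, K x y ^ 2 ∂μ ∂μ = ∫ z, K z.1 z.2 ^ 2 ∂(μ.prod μ) :=
  (integral_prod _ hK.integrable_sq).symm

/-- `x ↦ ∫ K(x,y) φ(y) dμ(y)` is a.e.-strongly measurable (Fubini integrand). [folklore] -/
theorem aestronglyMeasurable_integral_l2Kernel_mul (hK : AEStronglyMeasurable (uncurry K) (μ.prod μ))
    (φ : Lp ℝ 2 μ) : AEStronglyMeasurable (fun x => ∫ y, K x y * φ y ∂μ) μ := by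
  have h : AEStronglyMeasurable (fun z : X × X => K z.1 z.2 * φ z.2) (μ.prod μ) :=
    hK.mul (Lp.aestronglyMeasurable φ).comp_snd
  exact h.integral_prod_right'

/-- **`A φ ∈ L²`**: `x ↦ ∫ K(x,y) φ(y) dμ(y)` is square integrable, dominated by
`‖φ‖ · (∫ K(x,y)² dμ(y))^{1/2}`. [folklore] -/
theorem memLp_two_integral_l2Kernel_mul (hK : MemLp (uncurry K) 2 (μ.prod μ)) (φ : Lp ℝ 2 μ) :
    MemLp (fun x => ∫ y, K x y * φ y ∂μ) 2 μ := by
  have hR := integrable_integral_l2Kernel_sq hK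
  have hg : MemLp (fun x => Real.sqrt (∫ y, K x y ^ 2 ∂μ)) 2 μ := by
    rw [memLp_two_iff_integrable_sq (Real.continuous_sqrt.comp_aestronglyMeasurable hR.1)]
    refine hR.congr (Eventually.of_forall fun x => ?_)
    dsimp only
    rw [Real.sq_sqrt (integral_nonneg fun y => sq_nonneg _)]
  refine MemLp.of_le_mul (c := ‖φ‖) hg (aestronglyMeasurable_integral_l2Kernel_mul hK.1 φ) ?_
  filter_upwards [ae_memLp_l2Kernel_section hK] with x hx
  rw [Real.norm_eq_abs, Real.norm_of_nonneg (Real.sqrt_nonneg _), mul_comm,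
    ← Real.sqrt_sq (norm_nonneg φ), ← Real.sqrt_mul (integral_nonneg fun y => sq_nonneg _)]
  exact Real.abs_le_sqrt (sq_integral_l2Kernel_mul_le hx φ)

/-- **The `L²` bound** `∫ (∫ K(x,y) φ(y) dμ(y))² dμ(x) ≤ ‖K‖²_{L²(μ⊗μ)} ‖φ‖²`. [folklore] -/
theorem integral_sq_integral_l2Kernel_mul_le (hK : MemLp (uncurry K) 2 (μ.prod μ)) (φ : Lp ℝ 2 μ) :
    ∫ x, (∫ y, K x y * φ y ∂μ) ^ 2 ∂μ ≤ (∫ z, K z.1 z.2 ^ 2 ∂(μ.prod μ)) * ‖φ‖ ^ 2 := by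
  rw [← integral_integral_l2Kernel_sq hK, ← integral_mul_const]
  refine integral_mono_ae (memLp_two_integral_l2Kernel_mul hK φ).integrable_sq
    ((integrable_integral_l2Kernel_sq hK).mul_const _) ?_
  filter_upwards [ae_memLp_l2Kernel_section hK] with x hx
  exact sq_integral_l2Kernel_mul_le hx φ

/-- `‖toLp (A φ)‖² = ∫ (∫ K(x,y) φ(y))² ≤ ‖K‖²_{L²(μ⊗μ)} ‖φ‖²` in `L²(μ)`. [folklore] -/
theorem norm_toLp_integral_l2Kernel_mul_le (hK : MemLp (uncurry K) 2 (μ.prod μ)) (φ : Lp ℝ 2 μ) :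
    ‖(memLp_two_integral_l2Kernel_mul hK φ).toLp _‖ ≤
      Real.sqrt (∫ z, K z.1 z.2 ^ 2 ∂(μ.prod μ)) * ‖φ‖ := by
  have h : ‖(memLp_two_integral_l2Kernel_mul hK φ).toLp _‖ ^ 2 ≤
      (∫ z, K z.1 z.2 ^ 2 ∂(μ.prod μ)) * ‖φ‖ ^ 2 := by
    rw [norm_toLp_sq_eq_integral_norm_sq]
    simp only [Real.norm_eq_abs, sq_abs]
    exact integral_sq_integral_l2Kernel_mul_le hK φ
  rw [← abs_norm, ← Real.sqrt_sq (norm_nonneg φ), ← Real.sqrt_mul (integral_nonneg fun z => sq_nonneg _)]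
  exact Real.abs_le_sqrt h

/-! ### The integral operator -/

/-- **The integral operator of a square-integrable kernel** (Reed–Simon I, Thm. VI.23): for
`uncurry K ∈ L²(μ ⊗ μ)` there is a bounded operator `A` on `L²(μ)` with
`(Aφ)(x) = ∫ K(x, y) φ(y) dμ(y)` for a.e. `x` (an existence statement, so that no definition is
introduced; `A` is unique by `Lp.ext`, and `‖A‖ ≤ ‖K‖_{L²(μ⊗μ)}`). [cite: ReedSimonI1980, Thm. VI.23] -/
theorem exists_l2KernelOp (hK : MemLp (uncurry K) 2 (μ.prod μ)) :
    ∃ A : Lp ℝ 2 μ →L[ℝ] Lp ℝ 2 μ,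
      ∀ φ : Lp ℝ 2 μ, (A φ : X → ℝ) =ᵐ[μ] fun x => ∫ y, K x y * φ y ∂μ := by
  set F : Lp ℝ 2 μ → X → ℝ := fun φ x => ∫ y, K x y * φ y ∂μ with hF
  have hmem : ∀ φ, MemLp (F φ) 2 μ := fun φ => memLp_two_integral_l2Kernel_mul hK φ
  have hint : ∀ {x : X}, MemLp (K x) 2 μ → ∀ φ : Lp ℝ 2 μ, Integrable (fun y => K x y * φ y) μ :=
    fun hx φ => hx.integrable_mul (Lp.memLp φ)
  set L : Lp ℝ 2 μ →ₗ[ℝ] Lp ℝ 2 μ :=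
    { toFun := fun φ => (hmem φ).toLp (F φ)
      map_add' := fun φ ψ => by
        rw [← MemLp.toLp_add (hmem φ) (hmem ψ), MemLp.toLp_eq_toLp_iff]
        filter_upwards [ae_memLp_l2Kernel_section hK] with x hx
        change F (φ + ψ) x = F φ x + F ψ x
        simp only [hF]
        rw [← integral_add (hint hx φ) (hint hx ψ)]
        refine integral_congr_ae ?_
        filter_upwards [Lp.coeFn_add φ ψ] with y hy
        rw [hy, Pi.add_apply, mul_add]
      map_smul' := fun c φ => by
        rw [RingHom.id_apply, ← MemLp.toLp_const_smul, MemLp.toLp_eq_toLp_iff]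
        filter_upwards with x
        change F (c • φ) x = c • F φ x
        simp only [hF]
        rw [smul_eq_mul, ← integral_const_mul]
        refine integral_congr_ae ?_
        filter_upwards [Lp.coeFn_smul c φ] with y hy
        rw [hy, Pi.smul_apply, smul_eq_mul]
        ring } with hL
  have hLapply : ∀ φ, L φ = (hmem φ).toLp (F φ) := fun φ => rfl
  refine ⟨L.mkContinuousOfExistsBound ⟨Real.sqrt (∫ z, K z.1 z.2 ^ 2 ∂(μ.prod μ)), fun φ => ?_⟩,
    fun φ => ?_⟩
  · rw [hLapply]
    exact norm_toLp_integral_l2Kernel_mul_le hK φ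
  · rw [LinearMap.mkContinuousOfExistsBound_apply, hLapply]
    exact (hmem φ).coeFn_toLp

/-! ### Properties of an operator given by an `L²` kernel a.e. -/

variable {A : Lp ℝ 2 μ →L[ℝ] Lp ℝ 2 μ}

/-- **The Hilbert–Schmidt bound** (Reed–Simon I, Thm. VI.23, `‖A‖²_{HS} = ∫∫|K|²`, in the finite form
Mathlib can state without a Hilbert–Schmidt class): for every finite orthonormal family `(fᵢ)` of
`L²(μ)`, `∑ᵢ ‖A fᵢ‖² ≤ ∫ K² d(μ ⊗ μ)` — row-wise Bessel `∑ᵢ ⟪K(x,·), fᵢ⟫² ≤ ‖K(x,·)‖²`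
integrated over `x`. [cite: ReedSimonI1980, Thm. VI.23] -/
theorem sum_norm_sq_l2KernelOp_le (hK : MemLp (uncurry K) 2 (μ.prod μ))
    (hA : ∀ φ : Lp ℝ 2 μ, (A φ : X → ℝ) =ᵐ[μ] fun x => ∫ y, K x y * φ y ∂μ)
    {m : ℕ} {f : Fin m → Lp ℝ 2 μ} (hf : Orthonormal ℝ f) :
    ∑ i, ‖A (f i)‖ ^ 2 ≤ ∫ z, K z.1 z.2 ^ 2 ∂(μ.prod μ) := by
  have hsq : ∀ i, ‖A (f i)‖ ^ 2 = ∫ x, (∫ y, K x y * f i y ∂μ) ^ 2 ∂μ := fun i => by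
    rw [norm_sq_eq_integral_norm_sq]
    refine integral_congr_ae ?_
    filter_upwards [hA (f i)] with x hx
    rw [hx, Real.norm_eq_abs, sq_abs]
  have hint : ∀ i, Integrable (fun x => (∫ y, K x y * f i y ∂μ) ^ 2) μ := fun i =>
    (memLp_two_integral_l2Kernel_mul hK (f i)).integrable_sq
  simp only [hsq]
  rw [← integral_finsetSum _ fun i _ => hint i, ← integral_integral_l2Kernel_sq hK]
  refine integral_mono_ae (integrable_finsetSum _ fun i _ => hint i)
    (integrable_integral_l2Kernel_sq hK) ?_
  filter_upwards [ae_memLp_l2Kernel_section hK] with x hx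
  simpa only [Finset.sum_apply] using sum_sq_integral_l2Kernel_mul_le hx hf

/-- **Compactness** of the integral operator of an `L²` kernel (Hilbert–Schmidt ⇒ compact: bounded
Hilbert–Schmidt sums over finite orthonormal families, tree
`isCompactOperator_of_orthonormal_sum_sq_le`; Reed–Simon I, Thm. VI.22–VI.23). [cite: ReedSimonI1980, Thm. VI.23] -/
theorem isCompactOperator_l2KernelOp (hK : MemLp (uncurry K) 2 (μ.prod μ))
    (hA : ∀ φ : Lp ℝ 2 μ, (A φ : X → ℝ) =ᵐ[μ] fun x => ∫ y, K x y * φ y ∂μ) : IsCompactOperator A :=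
  isCompactOperator_of_orthonormal_sum_sq_le A fun _ _ hf => sum_norm_sq_l2KernelOp_le hK hA hf

/-- **Self-adjointness**: a symmetric `L²` kernel gives a self-adjoint operator (Fubini on `μ ⊗ μ`).
[cite: ReedSimonI1980, Thm. VI.23] -/
theorem isSelfAdjoint_l2KernelOp (hK : MemLp (uncurry K) 2 (μ.prod μ)) (hsymm : ∀ x y, K x y = K y x)
    (hA : ∀ φ : Lp ℝ 2 μ, (A φ : X → ℝ) =ᵐ[μ] fun x => ∫ y, K x y * φ y ∂μ) : IsSelfAdjoint A := by
  rw [ContinuousLinearMap.isSelfAdjoint_iff_isSymmetric]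
  intro φ ψ
  change ⟪A φ, ψ⟫ = ⟪φ, A ψ⟫
  rw [real_inner_comm, inner_kernelOp_eq_integral hA, inner_kernelOp_eq_integral hA]
  have h1 : ∫ x, ψ x * ∫ y, K x y * φ y ∂μ ∂μ = ∫ x, ∫ y, ψ x * (K x y * φ y) ∂μ ∂μ :=
    integral_congr_ae (Eventually.of_forall fun x => (integral_const_mul (ψ x) _).symm)
  have h2 : ∫ x, φ x * ∫ y, K x y * ψ y ∂μ ∂μ = ∫ x, ∫ y, φ x * (K x y * ψ y) ∂μ ∂μ :=
    integral_congr_ae (Eventually.of_forall fun x => (integral_const_mul (φ x) _).symm)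
  rw [h1, h2, integral_integral_swap (integrable_mul_l2Kernel_mul hK ψ φ)]
  refine integral_congr_ae (Eventually.of_forall fun y => ?_)
  refine integral_congr_ae (Eventually.of_forall fun x => ?_)
  dsimp only
  rw [hsymm x y]
  ring

/-- **Integral operators with square-integrable kernels** (Reed–Simon I, Thm. VI.23), the package: for
`uncurry K ∈ L²(μ ⊗ μ)` on an s-finite measure space there is a bounded operator `A` on `L²(μ)` with
`(Aφ)(x) = ∫ K(x,y) φ(y) dμ(y)` a.e., and EVERY bounded `A` with this a.e. characterisation is compact,
self-adjoint when `K` is symmetric, satisfies the Hilbert–Schmidt bound `∑ᵢ ‖A fᵢ‖² ≤ ∫∫ K²` over finite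
orthonormal families, and `⟪ψ, Aφ⟫ = ∫ ψ(x) (∫ K(x,y) φ(y) dμ(y)) dμ(x)`. [cite: ReedSimonI1980, Thm. VI.23] -/
theorem exists_l2KernelOp_package (hK : MemLp (uncurry K) 2 (μ.prod μ)) :
    (∃ A : Lp ℝ 2 μ →L[ℝ] Lp ℝ 2 μ,
      ∀ φ : Lp ℝ 2 μ, (A φ : X → ℝ) =ᵐ[μ] fun x => ∫ y, K x y * φ y ∂μ) ∧
    (∀ A : Lp ℝ 2 μ →L[ℝ] Lp ℝ 2 μ,
      (∀ φ : Lp ℝ 2 μ, (A φ : X → ℝ) =ᵐ[μ] fun x => ∫ y, K x y * φ y ∂μ) →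
      IsCompactOperator A ∧
      ((∀ x y, K x y = K y x) → IsSelfAdjoint A) ∧
      (∀ (m : ℕ) (f : Fin m → Lp ℝ 2 μ), Orthonormal ℝ f →
        ∑ i, ‖A (f i)‖ ^ 2 ≤ ∫ z, K z.1 z.2 ^ 2 ∂(μ.prod μ)) ∧
      (∀ φ ψ : Lp ℝ 2 μ, ⟪ψ, A φ⟫ = ∫ x, ψ x * ∫ y, K x y * φ y ∂μ ∂μ)) :=
  ⟨exists_l2KernelOp hK, fun _ hA =>
    ⟨isCompactOperator_l2KernelOp hK hA, fun hsymm => isSelfAdjoint_l2KernelOp hK hsymm hA,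
      fun _ _ hf => sum_norm_sq_l2KernelOp_le hK hA hf, fun ψ φ => inner_kernelOp_eq_integral hA φ ψ⟩⟩

end Literature.Analysis.OperatorTheory

end
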